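import Literature.Barriers.CriticalPhenomena.LongRangeTrivialityOnZ3InfraredBoundHolds
import Literature.Barriers.CriticalPhenomena.LongRangeTrivialityOnZ3TreeWick

/-!
# `LongRangeTrivialityOnZ3_holds`: the barrier "triviality of the critical scaling limits of the
# reflection-positive long-range Ising models on `ℤ³` with effective dimension `> 4`" is a THEOREM

Sibling of `Literature/Barriers/CriticalPhenomena/LongRangeTrivialityOnZ3.lean` (barrier catalogue
D-0021, sub-problem `Ising3DConformalLimit`). That file vendors Panis's Theorem 1.2 / Corollary 1.11
(arXiv:2309.05797 = Ann. Probab. 54 (2026)) for `J_{x,y} = C₀|x-y|₁^{-3-α}`, `α ∈ (0,3/2)`, as the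
barrier `LongRangeTrivialityOnZ3`; `LongRangeTrivialityOnZ3TreeWick.lean` proved it granted ONE named
fact, the infrared bound `panis_infraredBound_algebraic` (`LongRangeTrivialityOnZ3.of_irb`), the other
printed inputs (the tree-graph Wick bound by random currents, the tree diagram bound, the
Messager–Miracle-Solé inequalities, `χ_L ≤ C₂L^{-d}Σ_L`, `β_c > 0`) having been proved in the tree;
`LongRangeTrivialityOnZ3InfraredBoundHolds.lean` discharges that fact by the torus route (reflection
positivity of the periodised power-law coupling, Gaussian domination on the even tori, the vanishing of
the torus zero mode below `β_c`, Griffiths' comparison free ≤ torus, the Fejér/Riemann-sum estimate and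
the MMS `x`-space step). Hence the barrier holds unconditionally (axioms `propext`, `Classical.choice`,
`Quot.sound`).

## References

* R. Panis, arXiv:2309.05797 (2023) = Ann. Probab. 54 (2026), Theorem 1.2, Corollary 1.11, §3, §4, §5
  [Panis2023Triviality].
* M. Aizenman, Commun. Math. Phys. 86 (1982) 1–48 (random currents, tree-graph bounds) [AizenmanCMP1982].
-/

namespace Literature.Barriers.CriticalPhenomena

/-- **The barrier `LongRangeTrivialityOnZ3` holds** (Panis 2023, Theorem 1.2 with Corollary 1.11 for
`d = 3`, `J_{x,y} = C₀|x-y|₁^{-3-α}`, `α ∈ (0,3/2)`): every subsequential scaling limit of the critical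
(or near-critical) smeared spin field is Gaussian — proved from the tree's `LongRangeTrivialityOnZ3.of_irb`
and the discharged infrared bound `panis_infraredBound_algebraic_holds`. [cite: Panis2023Triviality, Theorem 1.2 and Corollary 1.11] -/
theorem LongRangeTrivialityOnZ3_holds : LongRangeTrivialityOnZ3 :=
  LongRangeTrivialityOnZ3.of_irb panis_infraredBound_algebraic_holds

end Literature.Barriers.CriticalPhenomena
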